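import Mathlib
import Summits.NavierStokesRegularity.NavierStokesRegularity.Theorems.L3TimeExponentPincerJawEnergyFloor
import Summits.NavierStokesRegularity.NavierStokesRegularity.Theorems.L3TimeExponentPincerJawMorreyRateHolds
import HarnessLib.Audit
import HarnessLib

/-!
# The dissipation axis and the coupled Morrey–dissipation criterion of the jaw
# (route `L3TimeExponentPincer`, crux `L3CascadeJaw`, stmt-NavierStokesRegularity-19499)
Support file for the parent crux `L3CascadeJaw` (cell ns-regularity-ideate, seat nsreg-p2, ROUND-10).
The crux asks, for every `q ∈ (4,5)`, that every frame solution (classical on `[0,T)`, Leray–Hopf from a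
rapidly decaying datum) is in `L^q_t L³_x` on a final window.  The tree decides it on the classes defined by
the worst-ball SCALED ENERGY `Φ(t)` (J′: `Φ` bounded ⇒ all `q ≤ 6`; J″: `Φ ∈ L^{q/(6-q)}_t` ⇒ exponent `q`).
This file adds the second axis of the a priori bookkeeping — the DISSIPATION RATE
`δ(t) = ∫ |∇u(t)|²` (`dissipRate`) — and the coupled criterion from which J′ and J″ descend:
* `jaw_of_dissipIntegrability` — **`∫_{T₁}^{T} δ^{q/4} < ∞ ⇒ u ∈ L^q_t L³_x` near `T`** (any `q ≥ 0`):
  the energy-class slice inequality `‖u(t)‖₃⁴ ≤ 2E(u₀) K² δ(t)` (`eLpNorm_three_rpow_four_le`) raised to the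
  power `q/4`.  Exponent map of the dissipation face: `δ ∈ L^b_t ⇒ q = 4b`; `b = 1` is the energy identity
  (the known floor `q = 4`, `l3Jaw_four`), `b = 5/4` gives the whole clause `q < 5`.
* `lintegral_dissipRate_rpow_lt_top_of_powerRate`, `jaw_of_dissipPowerRate`,
  `l3CascadeJaw_clause_of_dissipPowerRate` — the power-law sub-case `δ(t) ≤ C (T-t)^{-γ}`: exponent `q` for
  `γ q < 4`; **`γ ≤ 4/5` gives every `q ∈ (4,5)`**, `γ < 1` (the integrability border of `δ`) gives some `q > 4`.
  Calibration (docstrings only): a parabolic Type-I profile has `γ = 1/2` (`q < 8`); the energy-conserving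
  dyadic cascade has `γ = 4/5` exactly at the clause border `q = 5`, where its Morrey rate is `(T-t)^{-2/5}`,
  outside J″'s power-rate range `β ≤ 1/5` — the dissipation axis is sharp on cascades, J″ is not.
* `jaw_of_coupledMorreyDissip` — **the coupled criterion** `∫_{T₁}^{T} (Φ(t) δ(t))^{q/6} dt < ∞ ⇒ u ∈ L^q_t L³_x`
  (`0 ≤ q ≤ 6`, `Φ` any Morrey-rate majorant, no measurability needed): the slice bound
  `(∫|u|³)² ≲ (Φ+1) e₀ δ` (`sliceBound_holds`) integrated WITHOUT Young's inequality.  J′ is the case `Φ`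
  bounded, J″ is Young applied to `(Φ δ)^{q/6}`; the coupled form keeps the correlation of `Φ` and `δ`
  (exact on cascades: `q < 6/(β+γ)`).
* `AllBlowupsDissipationFiveFourths` (`@[conjecture]`, OPEN) — "every frame blow-up has `δ ∈ L^b(T₁,T)` for all
  `b < 5/4`" — and `l3CascadeJaw_of_allBlowupsDissipationFiveFourths : _ → L3CascadeJaw`, the parent crux BY
  NAME through the dissipation face (smooth branch = the landed `jawSmoothBranch_holds`).  This node is NOT
  implied by and does not imply `AllBlowupsFullMorreyB`; both sit strictly below `NoTypeII ∧ …` only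
  heuristically — see the ROUND-10 memo for the comparison and for why the node is riskier than the crux.
References: J. C. Robinson, J. L. Rodrigo, W. Sadowski, *The three-dimensional Navier–Stokes equations* (2016),
Lemma 3.5 and the `L^r_t L^s_x` scale `2/r + 3/s = 3/2`; T. Barker, *Higher integrability and the number of
singular points for the Navier–Stokes equations with a scale-invariant bound*, arXiv:2111.14776 (PAMS B 2024),
Thm 1 / Cor 1 (the only printed supercritical gain on the dissipation side, under `L^∞_t L^{3,∞}_x`).
WHAT THIS IS NOT: not a claim about Navier–Stokes regularity or blow-up; no item is closed; the
`@[conjecture]` node is open and is recorded as a typed hypothesis, not asserted.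
-/
noncomputable section
namespace Summit.NavierStokesRegularity.NavierStokesRegularity.Theorems.L3TimeExponentPincerDissipationAxis
open MeasureTheory Set Function Filter Metric Topology
open scoped ENNReal NNReal
open Literature.Analysis.FluidPDE
open Summit.NavierStokesRegularity.NavierStokesRegularity.Theorems.L3TimeExponentPincerMorreyGrowth
open Summit.NavierStokesRegularity.NavierStokesRegularity.Theorems.L3TimeExponentPincerJawFullMorrey
open Summit.NavierStokesRegularity.NavierStokesRegularity.Theorems.L3TimeExponentPincerJawMorreyRate
open Summit.NavierStokesRegularity.NavierStokesRegularity.Theorems.L3TimeExponentPincerJawFullMorreyHolds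
  (sliceBound_holds)
open Summit.NavierStokesRegularity.NavierStokesRegularity.Theorems.L3TimeExponentPincerJawEnergyFloor
  (eLpNorm_three_rpow_four_le)
open Summit.NavierStokesRegularity.NavierStokesRegularity.Theses.L3TimeExponentPincer (L3CascadeJaw)
/-! ### An elementary `ℝ≥0∞` power bound (`x^s ≤ x + 1`, `0 ≤ s ≤ 1`, is the tree's
`…Theorems.BoundedEnvelope.rpow_le_self_add_one`; it is re-derived inline below to keep the import cone small) -/
/-- `(x+y)^a ≤ 2^a (x^a + y^a)` for `0 ≤ a`. [folklore] -/
theorem add_rpow_le_two_rpow (x y : ℝ≥0∞) {a : ℝ} (ha : 0 ≤ a) :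
    (x + y) ^ a ≤ (2 : ℝ≥0∞) ^ a * (x ^ a + y ^ a) := by
  rcases le_total x y with hxy | hxy
  · calc (x + y) ^ a ≤ (y + y) ^ a := ENNReal.rpow_le_rpow (add_le_add hxy le_rfl) ha
      _ = (2 * y) ^ a := by rw [two_mul]
      _ = 2 ^ a * y ^ a := ENNReal.mul_rpow_of_nonneg _ _ ha
      _ ≤ 2 ^ a * (x ^ a + y ^ a) := by gcongr; exact le_add_self
  · calc (x + y) ^ a ≤ (x + x) ^ a := ENNReal.rpow_le_rpow (add_le_add le_rfl hxy) ha
      _ = (2 * x) ^ a := by rw [two_mul]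
      _ = 2 ^ a * x ^ a := ENNReal.mul_rpow_of_nonneg _ _ ha
      _ ≤ 2 ^ a * (x ^ a + y ^ a) := by gcongr; exact le_self_add
/-! ### The dissipation face: `δ ∈ L^{q/4}_t ⇒ u ∈ L^q_t L³_x` -/
/-- **Dissipation integrability ⇒ the jaw at exponent `q`.**  For a classical solution on `[0,T)` that is
Leray–Hopf on `[0,T]` from `u 0`: if `∫_{T₁}^{T} δ(t)^{q/4} dt < ∞` (`δ = dissipRate u`, `q ≥ 0`) then
`∫_{T₂}^{T} ‖u(t)‖₃^q dt < ∞` for some `T₂ ∈ (0,T)`.  Proof: the slice inequality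
`‖u(t)‖₃⁴ ≤ 2E(u₀) · K² · δ(t)` raised to the power `q/4` and integrated.  The case `q = 4` is the energy
identity (`l3Jaw_four`); `δ ∈ L^b_t` gives `q = 4b`. [cite: RobinsonRodrigoSadowski2016, Lemma 3.5] -/
theorem jaw_of_dissipIntegrability {ν T : ℝ} (hν : 0 < ν) (hT : 0 < T)
    {u : ℝ → (EuclideanSpace ℝ (Fin 3)) → (EuclideanSpace ℝ (Fin 3))} {p : ℝ → (EuclideanSpace ℝ (Fin 3)) → ℝ}
    (hcl : IsClassicalNSSolutionOn (Ico 0 T) ν 0 u p) (hLH : IsLerayHopfOn T ν 0 (u 0) u)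
    {q : ℝ} (hq0 : 0 ≤ q)
    (hint : ∃ T₁ < T, ∫⁻ t in Ioo T₁ T, (dissipRate u t) ^ (q / 4) < ⊤) :
    ∃ T₂ ∈ Ioo 0 T, (∫⁻ t in Ioo T₂ T, eLpNorm (u t) 3 volume ^ q) < ⊤ := by
  obtain ⟨T₁, hT₁, hint⟩ := hint
  set K : ℝ≥0 := SNormLESNormFDerivOfEqConst (EuclideanSpace ℝ (Fin 3))
    (volume : Measure (EuclideanSpace ℝ (Fin 3))) 2 with hK
  set E₀ : ℝ≥0∞ := ENNReal.ofReal (2 * VectorCalculus.kineticEnergy (u 0)) with hE₀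
  have hq4 : 0 ≤ q / 4 := by positivity
  set A : ℝ≥0∞ := (E₀ * (K : ℝ≥0∞) ^ 2) ^ (q / 4) with hA
  have hAtop : A ≠ ⊤ := ENNReal.rpow_ne_top_of_nonneg hq4
    (ENNReal.mul_ne_top ENNReal.ofReal_ne_top (ENNReal.pow_ne_top ENNReal.coe_ne_top))
  set T₂ : ℝ := max T₁ (T / 2) with hT₂
  have hT₂mem : T₂ ∈ Ioo 0 T := ⟨lt_max_of_lt_right (by linarith), max_lt hT₁ (by linarith)⟩
  have hpt : ∀ t ∈ Ioo T₂ T, eLpNorm (u t) 3 volume ^ q ≤ A * (dissipRate u t) ^ (q / 4) := by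
    intro t ht
    have ht0 : 0 < t := hT₂mem.1.trans ht.1
    have htc : t ∈ Ico 0 T := ⟨ht0.le, ht.2⟩
    have hen : ∫⁻ x, ‖u t x‖ₑ ^ 2 ≤ E₀ := hLH.lintegral_enorm_sq_le hν.le ⟨ht0.le, ht.2.le⟩
    have h1 := eLpNorm_three_rpow_four_le ((hcl.contDiff_velocity htc).of_le (by norm_cast))
      (hen.trans_lt ENNReal.ofReal_lt_top)
    have h2 : eLpNorm (u t) 3 volume ^ (4 : ℝ) ≤ E₀ * (K : ℝ≥0∞) ^ 2 * dissipRate u t := by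
      rw [mul_assoc]
      exact h1.trans (mul_le_mul' hen le_rfl)
    have h3 : eLpNorm (u t) 3 volume ^ q = (eLpNorm (u t) 3 volume ^ (4 : ℝ)) ^ (q / 4) := by
      rw [← ENNReal.rpow_mul]
      congr 1
      ring
    rw [h3, hA, ← ENNReal.mul_rpow_of_nonneg _ _ hq4]
    exact ENNReal.rpow_le_rpow h2 hq4
  refine ⟨T₂, hT₂mem, ?_⟩
  calc ∫⁻ t in Ioo T₂ T, eLpNorm (u t) 3 volume ^ q
      ≤ ∫⁻ t in Ioo T₂ T, A * (dissipRate u t) ^ (q / 4) := setLIntegral_mono' measurableSet_Ioo hpt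
    _ = A * ∫⁻ t in Ioo T₂ T, (dissipRate u t) ^ (q / 4) := lintegral_const_mul' _ _ hAtop
    _ ≤ A * ∫⁻ t in Ioo T₁ T, (dissipRate u t) ^ (q / 4) :=
        mul_le_mul' le_rfl (lintegral_mono_set (Ioo_subset_Ioo_left (le_max_left _ _)))
    _ < ⊤ := ENNReal.mul_lt_top hAtop.lt_top hint
/-- **First bite on the dissipation side ⇒ first bite on the `L³` side**: `δ ∈ L^b(T₁,T)` for some `b > 1`
gives `u ∈ L^q_t L³_x` near `T` with `q = 4b > 4` (the crux's first non-trivial rung). -/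
theorem l3Bite_of_dissipBite {ν T : ℝ} (hν : 0 < ν) (hT : 0 < T)
    {u : ℝ → (EuclideanSpace ℝ (Fin 3)) → (EuclideanSpace ℝ (Fin 3))} {p : ℝ → (EuclideanSpace ℝ (Fin 3)) → ℝ}
    (hcl : IsClassicalNSSolutionOn (Ico 0 T) ν 0 u p) (hLH : IsLerayHopfOn T ν 0 (u 0) u)
    {b : ℝ} (hb : 1 < b) (hint : ∃ T₁ < T, ∫⁻ t in Ioo T₁ T, (dissipRate u t) ^ b < ⊤) :
    ∃ q : ℝ, 4 < q ∧ ∃ T₂ ∈ Ioo 0 T, (∫⁻ t in Ioo T₂ T, eLpNorm (u t) 3 volume ^ q) < ⊤ := by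
  refine ⟨4 * b, by linarith, jaw_of_dissipIntegrability hν hT hcl hLH (by linarith) ?_⟩
  have h : 4 * b / 4 = b := by ring
  rw [h]
  exact hint
/-! ### The power-law sub-case `δ(t) ≤ C (T-t)^{-γ}` -/
/-- `δ(t) ≤ C (T-t)^{-γ}` on `(T₁,T)` gives `∫_{T₁}^{T} δ^b < ∞` whenever `0 ≤ b` and `γ b < 1`. -/
theorem lintegral_dissipRate_rpow_lt_top_of_powerRate {T : ℝ}
    {u : ℝ → (EuclideanSpace ℝ (Fin 3)) → (EuclideanSpace ℝ (Fin 3))}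
    {C γ T₁ : ℝ} (hC : 0 ≤ C) (hT₁ : T₁ < T)
    (hrate : ∀ t ∈ Ioo T₁ T, dissipRate u t ≤ ENNReal.ofReal (C * (T - t) ^ (-γ)))
    {b : ℝ} (hb0 : 0 ≤ b) (hγb : γ * b < 1) :
    ∫⁻ t in Ioo T₁ T, (dissipRate u t) ^ b < ⊤ := by
  have hpt : ∀ t ∈ Ioo T₁ T, (dissipRate u t) ^ b ≤
      ENNReal.ofReal (C ^ b * (T - t) ^ (-(γ * b))) := by
    intro t ht
    have hTt : 0 < T - t := by linarith [ht.2]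
    calc (dissipRate u t) ^ b ≤ (ENNReal.ofReal (C * (T - t) ^ (-γ))) ^ b :=
          ENNReal.rpow_le_rpow (hrate t ht) hb0
      _ = ENNReal.ofReal (C ^ b * (T - t) ^ (-(γ * b))) := by
          rw [ENNReal.ofReal_rpow_of_nonneg (mul_nonneg hC (Real.rpow_nonneg hTt.le _)) hb0,
            Real.mul_rpow hC (Real.rpow_nonneg hTt.le _), ← Real.rpow_mul hTt.le, neg_mul]
  calc ∫⁻ t in Ioo T₁ T, (dissipRate u t) ^ b
      ≤ ∫⁻ t in Ioo T₁ T, ENNReal.ofReal (C ^ b * (T - t) ^ (-(γ * b))) :=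
        setLIntegral_mono' measurableSet_Ioo hpt
    _ < ⊤ := lintegral_Ioo_rpow_neg_lt_top hT₁ hγb
/-- **Power-law dissipation rate ⇒ the jaw**: `δ(t) ≤ C (T-t)^{-γ}` near `T` gives `u ∈ L^q_t L³_x` near `T`
for every `q ≥ 0` with `γ q < 4` (`γ = 1/2`, the parabolic Type-I value: all `q < 8`; `γ < 1`: some `q > 4`). -/
theorem jaw_of_dissipPowerRate {ν T : ℝ} (hν : 0 < ν) (hT : 0 < T)
    {u : ℝ → (EuclideanSpace ℝ (Fin 3)) → (EuclideanSpace ℝ (Fin 3))} {p : ℝ → (EuclideanSpace ℝ (Fin 3)) → ℝ}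
    (hcl : IsClassicalNSSolutionOn (Ico 0 T) ν 0 u p) (hLH : IsLerayHopfOn T ν 0 (u 0) u)
    {C γ T₁ : ℝ} (hC : 0 ≤ C) (hT₁ : T₁ < T)
    (hrate : ∀ t ∈ Ioo T₁ T, dissipRate u t ≤ ENNReal.ofReal (C * (T - t) ^ (-γ)))
    {q : ℝ} (hq0 : 0 ≤ q) (hγq : γ * q < 4) :
    ∃ T₂ ∈ Ioo 0 T, (∫⁻ t in Ioo T₂ T, eLpNorm (u t) 3 volume ^ q) < ⊤ := by
  refine jaw_of_dissipIntegrability hν hT hcl hLH hq0 ⟨T₁, hT₁, ?_⟩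
  have hγ' : γ * (q / 4) < 1 := by
    have h : γ * (q / 4) = γ * q / 4 := by ring
    rw [h, div_lt_one (by norm_num : (0 : ℝ) < 4)]
    exact hγq
  exact lintegral_dissipRate_rpow_lt_top_of_powerRate hC hT₁ hrate (by positivity) hγ'
/-- **The `L3CascadeJaw` clause under a `(T-t)^{-4/5}` dissipation rate**: every `q ∈ (4,5)`, i.e. the whole
clause of the parent crux, for frame solutions whose dissipation rate grows at most like `(T-t)^{-4/5}`
(the energy-conserving dyadic cascade sits exactly at this border; the decay hypothesis is not needed). -/
theorem l3CascadeJaw_clause_of_dissipPowerRate (q : ℝ) (hq4 : 4 < q) (hq5 : q < 5)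
    (ν T : ℝ) (hν : 0 < ν) (hT : 0 < T)
    (u : ℝ → (EuclideanSpace ℝ (Fin 3)) → (EuclideanSpace ℝ (Fin 3))) (p : ℝ → (EuclideanSpace ℝ (Fin 3)) → ℝ)
    (hcl : IsClassicalNSSolutionOn (Ico 0 T) ν 0 u p) (hLH : IsLerayHopfOn T ν 0 (u 0) u)
    {C γ T₁ : ℝ} (hC : 0 ≤ C) (hγ : γ ≤ 4 / 5) (hT₁ : T₁ < T)
    (hrate : ∀ t ∈ Ioo T₁ T, dissipRate u t ≤ ENNReal.ofReal (C * (T - t) ^ (-γ))) :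
    ∃ T₂ ∈ Ioo 0 T, (∫⁻ t in Ioo T₂ T, eLpNorm (u t) 3 volume ^ q) < ⊤ :=
  jaw_of_dissipPowerRate hν hT hcl hLH hC hT₁ hrate (by linarith) (by nlinarith)
/-! ### The coupled Morrey–dissipation criterion (J″ before Young) -/
/-- `t ↦ δ(t)` is a.e.-measurable on `(0,T)` for a classical solution (continuity of the classical gradient on
the open slab, Tonelli measurability). -/
theorem aemeasurable_dissipRate {ν T : ℝ}
    {u : ℝ → (EuclideanSpace ℝ (Fin 3)) → (EuclideanSpace ℝ (Fin 3))} {p : ℝ → (EuclideanSpace ℝ (Fin 3)) → ℝ}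
    (hcl : IsClassicalNSSolutionOn (Ico 0 T) ν 0 u p) :
    AEMeasurable (fun t => dissipRate u t) ((volume : Measure ℝ).restrict (Ioo 0 T)) := by
  set g : ℝ × EuclideanSpace ℝ (Fin 3) → ℝ≥0∞ :=
    fun z => ENNReal.ofReal (frobeniusNormSq (fderiv ℝ (u z.1) z.2)) with hg
  have hcont : ContinuousOn g (Ioo 0 T ×ˢ (univ : Set (EuclideanSpace ℝ (Fin 3)))) := by
    have h1 : ContinuousOn (fun z : ℝ × EuclideanSpace ℝ (Fin 3) => fderiv ℝ (u z.1) z.2)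
        (Ioo 0 T ×ˢ (univ : Set (EuclideanSpace ℝ (Fin 3)))) :=
      (hcl.smooth_velocity.continuousOn_fderiv_slice (uniqueDiffOn_Ico 0 T)).mono
        (prod_mono Ioo_subset_Ico_self Subset.rfl)
    exact (ENNReal.continuous_ofReal.comp continuous_frobeniusNormSq').comp_continuousOn h1
  have hprod : ((volume : Measure ℝ).restrict (Ioo 0 T)).prod
      (volume : Measure (EuclideanSpace ℝ (Fin 3))) =
      (volume : Measure (ℝ × EuclideanSpace ℝ (Fin 3))).restrict (Ioo 0 T ×ˢ univ) := by
    rw [Measure.restrict_prod_eq_prod_univ, ← Measure.volume_eq_prod]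
  have hgm : AEMeasurable g
      (((volume : Measure ℝ).restrict (Ioo 0 T)).prod (volume : Measure (EuclideanSpace ℝ (Fin 3)))) := by
    rw [hprod]
    exact hcont.aemeasurable (measurableSet_Ioo.prod MeasurableSet.univ)
  show AEMeasurable (fun t => ∫⁻ x, g (t, x)) _
  exact hgm.lintegral_prod_right'
/-- **The coupled criterion (J″ before Young).**  For a frame solution with a Morrey-rate majorant `Φ`
(`MorreyRateNear u T Φ`: `∫_{B(x₀,r)}|u(t)|² ≤ Φ(t) r` for late `t`, `r < r₁`) and `0 ≤ q ≤ 6`: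
`∫_{T₁}^{T} (Φ(t) δ(t))^{q/6} dt < ∞ ⇒ ∫_{T₂}^{T} ‖u(t)‖₃^q dt < ∞`.  Proof: the unconditional slice bound
`∫|u(t)|³ ≤ c · growthConst(Φ(t)+1, e₀, r₁) · 2√e₀ · δ(t)^{1/2}` (`sliceBound_holds`) with
`growthConst(M,e₀,r₁) ≤ C₁ √M`, raised to `q/3`: `‖u(t)‖₃^q ≤ C ((Φ(t)+1) δ(t))^{q/6}
≤ C 2^{q/6} ((Φδ)^{q/6} + δ + 1)`, and `∫ δ < ∞`.  J′ (`Φ` bounded, `q ≤ 6`) and J″ (Young: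
`(Φδ)^{q/6} ≤ Φ^{q/(6-q)} + δ`) are corollaries; the coupled form loses nothing when `Φ` and `δ` peak together. -/
theorem jaw_of_coupledMorreyDissip {ν T : ℝ} (hν : 0 < ν) (hT : 0 < T)
    {u : ℝ → (EuclideanSpace ℝ (Fin 3)) → (EuclideanSpace ℝ (Fin 3))} {p : ℝ → (EuclideanSpace ℝ (Fin 3)) → ℝ}
    (hcl : IsClassicalNSSolutionOn (Ico 0 T) ν 0 u p) (hLH : IsLerayHopfOn T ν 0 (u 0) u)
    {Φ : ℝ → ℝ≥0} (hΦ : MorreyRateNear u T Φ) {q : ℝ} (hq0 : 0 ≤ q) (hq6 : q ≤ 6)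
    (hint : ∃ T₁' < T, ∫⁻ t in Ioo T₁' T, ((Φ t : ℝ≥0∞) * dissipRate u t) ^ (q / 6) < ⊤) :
    ∃ T₂ ∈ Ioo 0 T, (∫⁻ t in Ioo T₂ T, eLpNorm (u t) 3 volume ^ q) < ⊤ := by
  obtain ⟨c, hc⟩ := sliceBound_holds
  obtain ⟨r₁, hr₁, T₁, hT₁, hMor⟩ := hΦ
  obtain ⟨T₁', hT₁', hint⟩ := hint
  set e₀ : ℝ := 2 * VectorCalculus.kineticEnergy (u 0) with he₀
  have he₀nn : 0 ≤ e₀ := mul_nonneg zero_le_two (kineticEnergy_nonneg _)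
  set T₂ : ℝ := max (max T₁ T₁') (T / 2) with hT₂
  have hT₂mem : T₂ ∈ Ioo 0 T :=
    ⟨lt_max_of_lt_right (by linarith), max_lt (max_lt hT₁ hT₁') (by linarith)⟩
  have hq3 : 0 ≤ q / 3 := by positivity
  have hs0 : 0 ≤ q / 6 := by positivity
  have hs1 : q / 6 ≤ 1 := by
    rw [div_le_one (by norm_num : (0 : ℝ) < 6)]
    exact hq6
  have hexp4 : (1 / 2 : ℝ) * (q / 3) = q / 6 := by ring
  -- constants
  set B : ℝ≥0∞ := 2 * (ENNReal.ofReal e₀) ^ (1 / 2 : ℝ) with hB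
  set C₁ : ℝ := Real.sqrt V₁ * (1 + Real.sqrt (e₀ / r₁)) with hC₁
  have hC₁nn : 0 ≤ C₁ := by positivity
  set L : ℝ≥0∞ := ((c : ℝ≥0∞) * ENNReal.ofReal C₁ * B) ^ (q / 3) * (2 : ℝ≥0∞) ^ (q / 6) with hL
  have hBtop : B ≠ ⊤ :=
    ENNReal.mul_ne_top (by norm_num) (ENNReal.rpow_ne_top_of_nonneg (by norm_num) ENNReal.ofReal_ne_top)
  have hLtop : L ≠ ⊤ := by
    refine ENNReal.mul_ne_top (ENNReal.rpow_ne_top_of_nonneg hq3 ?_)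
      (ENNReal.rpow_ne_top_of_nonneg hs0 (by norm_num))
    exact ENNReal.mul_ne_top (ENNReal.mul_ne_top ENNReal.coe_ne_top ENNReal.ofReal_ne_top) hBtop
  -- the pointwise bound at late times
  have hpt : ∀ t ∈ Ioo T₂ T,
      eLpNorm (u t) 3 volume ^ q ≤
        L * (((Φ t : ℝ≥0∞) * dissipRate u t) ^ (q / 6) + (dissipRate u t + 1)) := by
    intro t ht
    have htT₁ : T₁ < t := lt_of_le_of_lt ((le_max_left _ _).trans (le_max_left _ _)) ht.1
    have ht0 : 0 < t := hT₂mem.1.trans ht.1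
    have htc : t ∈ Ico 0 T := ⟨ht0.le, ht.2⟩
    have hE : ∫⁻ y, ‖u t y‖ₑ ^ 2 ≤ ENNReal.ofReal e₀ := hLH.lintegral_enorm_sq_le hν.le ⟨ht0.le, ht.2.le⟩
    have hΦnn : 0 ≤ (Φ t : ℝ) := (Φ t).coe_nonneg
    have hMpos : 0 < (Φ t : ℝ) + 1 := by linarith
    have h1 := hc (u t) (hcl.contDiff_velocity htc) ((Φ t : ℝ) + 1) e₀ r₁ hMpos he₀nn hr₁ hE
      (fun x₀ r hr hrr => (hMor t ⟨htT₁, ht.2⟩ x₀ r hr hrr).trans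
        (ENNReal.ofReal_le_ofReal (by nlinarith)))
    -- the growth constant against `√(Φ+1)` (as in `jaw_of_morreyRate_holds`)
    have hG_le : (growthConst ((Φ t : ℝ) + 1) e₀ r₁ : ℝ≥0∞) ≤
        ENNReal.ofReal C₁ * ((Φ t : ℝ≥0∞) + 1) ^ (1 / 2 : ℝ) := by
      have hφ1 : ((Φ t : ℝ≥0∞) + 1) = ENNReal.ofReal ((Φ t : ℝ) + 1) := by
        rw [ENNReal.ofReal_add hΦnn zero_le_one, ENNReal.ofReal_coe_nnreal, ENNReal.ofReal_one]
      rw [coe_growthConst, hφ1, ENNReal.ofReal_rpow_of_nonneg hMpos.le (by norm_num),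
        ← ENNReal.ofReal_mul hC₁nn, ← Real.sqrt_eq_rpow]
      refine ENNReal.ofReal_le_ofReal ?_
      have hsq1 : 1 ≤ Real.sqrt ((Φ t : ℝ) + 1) := Real.one_le_sqrt.2 (by linarith)
      have hx : Real.sqrt ((Φ t : ℝ) + 1) + Real.sqrt (e₀ / r₁) ≤
          (1 + Real.sqrt (e₀ / r₁)) * Real.sqrt ((Φ t : ℝ) + 1) := by
        nlinarith [Real.sqrt_nonneg (e₀ / r₁), hsq1]
      calc Real.sqrt V₁ * (Real.sqrt ((Φ t : ℝ) + 1) + Real.sqrt (e₀ / r₁))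
          ≤ Real.sqrt V₁ * ((1 + Real.sqrt (e₀ / r₁)) * Real.sqrt ((Φ t : ℝ) + 1)) :=
            mul_le_mul_of_nonneg_left hx (Real.sqrt_nonneg _)
        _ = C₁ * Real.sqrt ((Φ t : ℝ) + 1) := by rw [hC₁]; ring
    -- `∫|u(t)|³ ≤ (c C₁ B) ((Φ+1)^{1/2} δ^{1/2})`
    have hX : ∫⁻ y, ‖u t y‖ₑ ^ (3 : ℕ) ≤
        ((c : ℝ≥0∞) * ENNReal.ofReal C₁ * B) *
          (((Φ t : ℝ≥0∞) + 1) ^ (1 / 2 : ℝ) * (dissipRate u t) ^ (1 / 2 : ℝ)) := by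
      calc ∫⁻ y, ‖u t y‖ₑ ^ (3 : ℕ)
          ≤ (c : ℝ≥0∞) * (growthConst ((Φ t : ℝ) + 1) e₀ r₁ : ℝ≥0∞) * (B * (dissipRate u t) ^ (1 / 2 : ℝ)) := h1
        _ ≤ (c : ℝ≥0∞) * (ENNReal.ofReal C₁ * ((Φ t : ℝ≥0∞) + 1) ^ (1 / 2 : ℝ)) *
              (B * (dissipRate u t) ^ (1 / 2 : ℝ)) := by gcongr
        _ = _ := by ring
    -- raise to the power `q/3`: `‖u‖₃^q ≤ (c C₁ B)^{q/3} ((Φ+1) δ)^{q/6}`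
    have hXq : eLpNorm (u t) 3 volume ^ q ≤
        ((c : ℝ≥0∞) * ENNReal.ofReal C₁ * B) ^ (q / 3) *
          (((Φ t : ℝ≥0∞) + 1) * dissipRate u t) ^ (q / 6) := by
      rw [eLpNorm_three_rpow_eq]
      calc (∫⁻ y, ‖u t y‖ₑ ^ (3 : ℕ)) ^ (q / 3)
          ≤ (((c : ℝ≥0∞) * ENNReal.ofReal C₁ * B) *
              (((Φ t : ℝ≥0∞) + 1) ^ (1 / 2 : ℝ) * (dissipRate u t) ^ (1 / 2 : ℝ))) ^ (q / 3) :=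
            ENNReal.rpow_le_rpow hX hq3
        _ = ((c : ℝ≥0∞) * ENNReal.ofReal C₁ * B) ^ (q / 3) *
              ((((Φ t : ℝ≥0∞) + 1) * dissipRate u t) ^ (1 / 2 : ℝ)) ^ (q / 3) := by
            rw [ENNReal.mul_rpow_of_nonneg _ _ hq3,
              ENNReal.mul_rpow_of_nonneg _ _ (by norm_num : (0 : ℝ) ≤ 1 / 2)]
        _ = _ := by rw [← ENNReal.rpow_mul, hexp4]
    -- split `((Φ+1) δ)^{q/6} ≤ 2^{q/6} ((Φ δ)^{q/6} + δ^{q/6})`, and `δ^{q/6} ≤ δ + 1`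
    have h5 : (((Φ t : ℝ≥0∞) + 1) * dissipRate u t) ^ (q / 6) ≤
        (2 : ℝ≥0∞) ^ (q / 6) *
          (((Φ t : ℝ≥0∞) * dissipRate u t) ^ (q / 6) + (dissipRate u t) ^ (q / 6)) := by
      rw [add_mul, one_mul]
      exact add_rpow_le_two_rpow _ _ hs0
    have hδ : (dissipRate u t) ^ (q / 6) ≤ dissipRate u t + 1 := by
      rcases le_total (dissipRate u t) 1 with hx | hx
      · exact (ENNReal.rpow_le_one hx hs0).trans le_add_self
      · exact ((ENNReal.rpow_le_rpow_of_exponent_le hx hs1).trans_eq (ENNReal.rpow_one _)).trans le_self_add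
    calc eLpNorm (u t) 3 volume ^ q ≤ _ := hXq
      _ ≤ ((c : ℝ≥0∞) * ENNReal.ofReal C₁ * B) ^ (q / 3) *
            ((2 : ℝ≥0∞) ^ (q / 6) *
              (((Φ t : ℝ≥0∞) * dissipRate u t) ^ (q / 6) + (dissipRate u t + 1))) :=
          mul_le_mul' le_rfl (h5.trans (mul_le_mul' le_rfl (add_le_add le_rfl hδ)))
      _ = L * (((Φ t : ℝ≥0∞) * dissipRate u t) ^ (q / 6) + (dissipRate u t + 1)) := by
          rw [hL]
          ring
  -- integrate in time
  refine ⟨T₂, hT₂mem, ?_⟩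
  have hdiss : ∫⁻ t in Ioo 0 T, dissipRate u t < ⊤ := dissip_lt_top hcl hLH
  have hT₁'T₂ : T₁' ≤ T₂ := (le_max_right T₁ T₁').trans (le_max_left _ _)
  have hδm : AEMeasurable (fun t => dissipRate u t + 1) ((volume : Measure ℝ).restrict (Ioo T₂ T)) :=
    ((aemeasurable_dissipRate hcl).mono_set (Ioo_subset_Ioo_left hT₂mem.1.le)).add_const 1
  calc ∫⁻ t in Ioo T₂ T, eLpNorm (u t) 3 volume ^ q
      ≤ ∫⁻ t in Ioo T₂ T, L * (((Φ t : ℝ≥0∞) * dissipRate u t) ^ (q / 6) + (dissipRate u t + 1)) :=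
        setLIntegral_mono' measurableSet_Ioo hpt
    _ = L * ∫⁻ t in Ioo T₂ T, (((Φ t : ℝ≥0∞) * dissipRate u t) ^ (q / 6) + (dissipRate u t + 1)) :=
        lintegral_const_mul' _ _ hLtop
    _ = L * ((∫⁻ t in Ioo T₂ T, ((Φ t : ℝ≥0∞) * dissipRate u t) ^ (q / 6)) +
          ((∫⁻ t in Ioo T₂ T, dissipRate u t) + ∫⁻ t in Ioo T₂ T, (1 : ℝ≥0∞))) := by
        rw [lintegral_add_right' _ hδm, lintegral_add_right _ measurable_const]
    _ < ⊤ := by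
        refine ENNReal.mul_lt_top hLtop.lt_top (ENNReal.add_lt_top.2 ⟨?_, ENNReal.add_lt_top.2 ⟨?_, ?_⟩⟩)
        · exact lt_of_le_of_lt (lintegral_mono_set (Ioo_subset_Ioo_left hT₁'T₂)) hint
        · exact lt_of_le_of_lt (lintegral_mono_set (Ioo_subset_Ioo_left hT₂mem.1.le)) hdiss
        · rw [setLIntegral_const, Real.volume_Ioo]
          exact ENNReal.mul_lt_top ENNReal.one_lt_top ENNReal.ofReal_lt_top
/-- J′ as a corollary of the coupled criterion (sanity link, all `0 ≤ q ≤ 6`, endpoint included):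
a bounded Morrey rate `Φ ≤ M` gives `(Φ δ)^{q/6} ≤ M^{q/6} (δ + 1)`, integrable. -/
theorem jaw_of_coupled_fullMorrey {ν T : ℝ} (hν : 0 < ν) (hT : 0 < T)
    {u : ℝ → (EuclideanSpace ℝ (Fin 3)) → (EuclideanSpace ℝ (Fin 3))} {p : ℝ → (EuclideanSpace ℝ (Fin 3)) → ℝ}
    (hcl : IsClassicalNSSolutionOn (Ico 0 T) ν 0 u p) (hLH : IsLerayHopfOn T ν 0 (u 0) u)
    (hFM : FullMorreyTypeINear u T) {q : ℝ} (hq0 : 0 ≤ q) (hq6 : q ≤ 6) :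
    ∃ T₂ ∈ Ioo 0 T, (∫⁻ t in Ioo T₂ T, eLpNorm (u t) 3 volume ^ q) < ⊤ := by
  obtain ⟨M, hrate⟩ := morreyRateNear_const_of_full hFM
  have hs0 : 0 ≤ q / 6 := by positivity
  have hs1 : q / 6 ≤ 1 := by
    rw [div_le_one (by norm_num : (0 : ℝ) < 6)]
    exact hq6
  refine jaw_of_coupledMorreyDissip hν hT hcl hLH hrate hq0 hq6 ⟨T / 2, by linarith, ?_⟩
  have hdiss : ∫⁻ t in Ioo 0 T, dissipRate u t < ⊤ := dissip_lt_top hcl hLH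
  have hT2 : (0 : ℝ) ≤ T / 2 := by linarith
  have hδm : AEMeasurable (fun t => dissipRate u t + 1) ((volume : Measure ℝ).restrict (Ioo (T / 2) T)) :=
    ((aemeasurable_dissipRate hcl).mono_set (Ioo_subset_Ioo_left hT2)).add_const 1
  have hpt : ∀ t ∈ Ioo (T / 2) T, ((M : ℝ≥0∞) * dissipRate u t) ^ (q / 6) ≤
      (M : ℝ≥0∞) ^ (q / 6) * (dissipRate u t + 1) := by
    intro t _
    rw [ENNReal.mul_rpow_of_nonneg _ _ hs0]
    refine mul_le_mul' le_rfl ?_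
    rcases le_total (dissipRate u t) 1 with hx | hx
    · exact (ENNReal.rpow_le_one hx hs0).trans le_add_self
    · exact ((ENNReal.rpow_le_rpow_of_exponent_le hx hs1).trans_eq (ENNReal.rpow_one _)).trans le_self_add
  have hMtop : (M : ℝ≥0∞) ^ (q / 6) ≠ ⊤ := ENNReal.rpow_ne_top_of_nonneg hs0 ENNReal.coe_ne_top
  calc ∫⁻ t in Ioo (T / 2) T, ((M : ℝ≥0∞) * dissipRate u t) ^ (q / 6)
      ≤ ∫⁻ t in Ioo (T / 2) T, (M : ℝ≥0∞) ^ (q / 6) * (dissipRate u t + 1) :=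
        setLIntegral_mono' measurableSet_Ioo hpt
    _ = (M : ℝ≥0∞) ^ (q / 6) * ((∫⁻ t in Ioo (T / 2) T, dissipRate u t) + ∫⁻ t in Ioo (T / 2) T, (1 : ℝ≥0∞)) := by
        rw [lintegral_const_mul' _ _ hMtop, lintegral_add_right _ measurable_const]
    _ < ⊤ := by
        refine ENNReal.mul_lt_top hMtop.lt_top (ENNReal.add_lt_top.2 ⟨?_, ?_⟩)
        · exact lt_of_le_of_lt (lintegral_mono_set (Ioo_subset_Ioo_left hT2)) hdiss
        · rw [setLIntegral_const, Real.volume_Ioo]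
          exact ENNReal.mul_lt_top ENNReal.one_lt_top ENNReal.ofReal_lt_top
/-! ### The node BY NAME: `AllBlowupsDissipationFiveFourths → L3CascadeJaw` -/
/-- **Every frame blow-up has `δ ∈ L^b(T₁,T)` for every `0 ≤ b < 5/4`** (equivalently: its energy curve is in
`W^{1,b}` up to the blow-up time for all `b < 5/4`).  OPEN; recorded as a typed hypothesis.  The energy identity
gives `b = 1`; the parabolic Type-I rate `δ ≲ (T-t)^{-1/2}` gives all `b < 2`; the energy-conserving dyadic
cascade gives exactly `b < 5/4`.  Not comparable with `AllBlowupsFullMorreyB`. -/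
@[conjecture] def AllBlowupsDissipationFiveFourths : Prop :=
  ∀ (ν T : ℝ), 0 < ν → 0 < T →
    ∀ (u : ℝ → (EuclideanSpace ℝ (Fin 3)) → (EuclideanSpace ℝ (Fin 3))) (p : ℝ → (EuclideanSpace ℝ (Fin 3)) → ℝ),
    IsClassicalNSSolutionOn (Ico 0 T) ν 0 u p → IsLerayHopfOn T ν 0 (u 0) u →
    HasRapidSpatialDecay (u 0) → ¬ HasSmoothExtensionPast ν 0 u T →
    ∀ b : ℝ, 0 ≤ b → b < 5 / 4 → ∃ T₁ < T, ∫⁻ t in Ioo T₁ T, (dissipRate u t) ^ b < ⊤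
/-- A `(T-t)^{-γ}` dissipation rate with `γ ≤ 4/5` gives the conclusion of the node for that solution. -/
theorem dissipFiveFourths_of_powerRate {T : ℝ}
    {u : ℝ → (EuclideanSpace ℝ (Fin 3)) → (EuclideanSpace ℝ (Fin 3))}
    {C γ T₁ : ℝ} (hC : 0 ≤ C) (hγ : γ ≤ 4 / 5) (hT₁ : T₁ < T)
    (hrate : ∀ t ∈ Ioo T₁ T, dissipRate u t ≤ ENNReal.ofReal (C * (T - t) ^ (-γ)))
    {b : ℝ} (hb0 : 0 ≤ b) (hb : b < 5 / 4) :
    ∃ T₁ < T, ∫⁻ t in Ioo T₁ T, (dissipRate u t) ^ b < ⊤ :=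
  ⟨T₁, hT₁, lintegral_dissipRate_rpow_lt_top_of_powerRate hC hT₁ hrate hb0 (by nlinarith)⟩
/-- **The parent crux BY NAME through the dissipation face**: `AllBlowupsDissipationFiveFourths ⇒ L3CascadeJaw`
(`stmt-NavierStokesRegularity-19499`); the smooth branch is the landed `jawSmoothBranch_holds`, the blow-up
branch is `jaw_of_dissipIntegrability` with `b = q/4 < 5/4`. -/
theorem l3CascadeJaw_of_allBlowupsDissipationFiveFourths (hA : AllBlowupsDissipationFiveFourths) :
    L3CascadeJaw := by
  intro q hq4 hq5 ν T hν hT u p hcl hLH hdec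
  by_cases hext : HasSmoothExtensionPast ν 0 u T
  · exact Summit.NavierStokesRegularity.NavierStokesRegularity.Theorems.L3TimeExponentPincerSmoothBranch.jawSmoothBranch_holds
      q hq4 hq5 ν T hν hT u p hcl hLH hdec hext
  · exact jaw_of_dissipIntegrability hν hT hcl hLH (by linarith)
      (hA ν T hν hT u p hcl hLH hdec hext (q / 4) (by linarith) (by linarith))
end Summit.NavierStokesRegularity.NavierStokesRegularity.Theorems.L3TimeExponentPincerDissipationAxis
end
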